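import Literature.NumberTheory.LFunctions.Zhang2022.KnifeEdgeLenZDegreeBarrier
import Summits.Parity.GeneralizedHardyLittlewood.Theorems.PsiGradedTablesClosePoly.Negative.DarkCellsNoClosing
import HarnessLib

/-!
# Negative lane of `PsiGradedTablesClosePoly` (h2′, stmt-Parity-22438): the EXACT closing criterion ON a class, the
# determinant certificate, and tightness of the Gershgorin row threshold (the coherent triple)

Y. Zhang, *Discrete mean estimates and the Landau–Siegel zero*, arXiv:2211.02515v1 [Zhang2022LandauSiegel] — an
unrefereed manuscript under adjudication; nothing here asserts any of its claims and nothing here is a statement about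
Landau–Siegel zeros. Desk lemmas of the §D first critic (ls-knife-crit-1; bracket sharpening (α) of 2026-08-28, adopted
by the §G referee in F1-THRESHOLD v1.1), (A)-free, pure algebra plus Zhang's `𝔅 ≥ 0` (`mainTermForm_nonneg_of_isH1`),
companion of `DarkCellsNoClosing` (necessary side: row threshold; sufficient side: one violated 2×2 minor):

* `gradedClosesOn_of_not_posSemidef`, **`gradedClosesOn_iff_exists_not_posSemidef`** — the EXACT criterion ON the class:
  `GradedClosesOn 𝒞 X₁ Y₁ X₂` iff at some in-class design whose three pairs lie in `𝒞` the `3×3` main-term matrix is NOT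
  positive semidefinite (class-relative twin of `KnifeEdge.gradedCloses_of_not_posSemidef` /
  `KnifeEdge.gradedCloses_iff_not_gradedPSD`);
* `gradedClosesOn_of_det_neg` — the DETERMINANT certificate: `Re det < 0` at such a design closes ON `𝒞` (a PSD matrix has
  `det ≥ 0`, `Matrix.PosSemidef.det_nonneg`); it catches designs no 2×2 minor catches (below);
* the COHERENT TRIPLE (`𝔅(f) = 𝔅(g₁) = 𝔅(g₂) = 𝔅`, the three cells real and equal to `−t`, `t ≥ 0`):
  `coherentTriple_gradedQuadForm_ones` (value `3𝔅 − 6t` at amplitudes `(1,1,1)`), **`coherentTriple_closesAt_iff`** (the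
  design closes iff `𝔅 < 2t` — so the row threshold `𝔅/2` of `exists_row_excess_of_gradedClosesOn` is ATTAINED: Gershgorin's
  necessary condition is also sufficient there and its constant cannot be improved), `gradedClosesOn_coherentTriple`
  (`𝔅 < 2t` ⇒ `GradedClosesOn 𝒞`), `coherentTriple_det` (`det = (𝔅 − 2t)(𝔅 + t)²`) and `coherentTriple_minors_intact`
  (for `t ≤ 𝔅` no 2×2 minor is violated) — hence for `𝔅/2 < t ≤ 𝔅` the design closes by the determinant while every minor
  certificate `gradedClosesOn_of_minor··` is silent: the three certificate shapes (one cell `> 𝔅`, Toeplitz pair `> 𝔅/√2`,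
  coherent triple `> 𝔅/2`) are genuinely different.

Bearing on h2′ (`…Theses.ZDegreeToeplitzBand.PsiGradedTablesClosePoly`, consequent `GradedClosesOn 𝒞 X₁ Y₁ X₂`): the sign
test on a sub-unit poly class is decided by positive-semidefiniteness of ONE in-class `3×3` table, and the least total
cell mass at which it can pass is the Gershgorin number `𝔅/2` per cell (three coherent live cells), not `𝔅`. No Theses
statement is asserted; no new `Prop`; standard axioms.
-/

noncomputable section

open Complex Real ComplexConjugate Matrix
open scoped ComplexOrder

namespace Summit.Parity.GeneralizedHardyLittlewood.Theorems.PsiGradedTablesClosePoly.Negative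

open Literature.NumberTheory.LFunctions.Zhang2022 Literature.NumberTheory.LFunctions.Zhang2022.KnifeEdge
open Literature.NumberTheory.LFunctions.Zhang2022.Repair Literature.NumberTheory.LFunctions.Zhang2022.Skeleton

variable {X₁ Y₁ X₂ : PairFunctional} {f f' g₁ g₁' g₂ g₂' : ℝ → ℂ} {𝒞 : PairClass}

/-! ### Part 1 — the exact criterion ON the class: closing inside `𝒞` ↔ some in-class design with pairs in `𝒞` is not PSD -/

/-- a conjugate-symmetric `3×3` Gram form takes real values (pure algebra). [folklore] -/
private theorem gram_conj_of_conjSymm {M : Fin 3 → Fin 3 → ℂ} (hM : ∀ a b, M b a = conj (M a b)) (s : Fin 3 → ℂ) :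
    conj (∑ a, ∑ b, s a * conj (s b) * M a b) = ∑ a, ∑ b, s a * conj (s b) * M a b := by
  rw [map_sum]
  simp_rw [map_sum, map_mul, Complex.conj_conj]
  rw [Finset.sum_comm]
  refine Finset.sum_congr rfl fun a _ => Finset.sum_congr rfl fun b _ => ?_
  rw [← hM b a]
  ring

/-- the Gram form of the amplitudes `star x` is the matrix quadratic form `x⋆Mx` (pure algebra). [folklore] -/
private theorem gram_star_eq_dotProduct (M : Matrix (Fin 3) (Fin 3) ℂ) (x : Fin 3 → ℂ) :
    (∑ a, ∑ b, (star x) a * conj ((star x) b) * M a b) = star x ⬝ᵥ (M *ᵥ x) := by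
  simp only [dotProduct, Matrix.mulVec, Pi.star_apply, Complex.star_def, Complex.conj_conj, Finset.mul_sum]
  refine Finset.sum_congr rfl fun a _ => Finset.sum_congr rfl fun b _ => ?_
  ring

/-- **«Not PSD at an in-class design with pairs in `𝒞` ⇒ closing ON `𝒞`» (proved; class-relative twin of
`KnifeEdge.gradedCloses_of_not_posSemidef`):** the main-term matrix is Hermitian, so a failure of positive
semidefiniteness is an amplitude vector with NEGATIVE REAL form — a closing witness inside the class.
[cite: Zhang2022LandauSiegel, §2 (2.16), §7 Prop 7.1 (7.2)] -/
theorem gradedClosesOn_of_not_posSemidef (hf : InClassPiece f f') (hg₁ : InClassPiece g₁ g₁') (hg₂ : InClassPiece g₂ g₂')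
    (h01 : 𝒞 f f' g₁ g₁') (h02 : 𝒞 f f' g₂ g₂') (h12 : 𝒞 g₁ g₁' g₂ g₂')
    (h : ¬ (gradedMainMatrix X₁ Y₁ X₂ f f' g₁ g₁' g₂ g₂').PosSemidef) : GradedClosesOn 𝒞 X₁ Y₁ X₂ := by
  set M := gradedMainMatrix X₁ Y₁ X₂ f f' g₁ g₁' g₂ g₂' with hM
  rw [Matrix.posSemidef_iff_dotProduct_mulVec, not_and] at h
  obtain ⟨x, hx⟩ := not_forall.mp (h (gradedMainMatrix_isHermitian X₁ Y₁ X₂ f f' g₁ g₁' g₂ g₂'))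
  refine ⟨f, f', g₁, g₁', g₂, g₂', star x, hf, hg₁, hg₂, h01, h02, h12, ?_⟩
  have hreal : (star x ⬝ᵥ (M *ᵥ x)).im = 0 := by
    rw [← gram_star_eq_dotProduct, ← Complex.conj_eq_iff_im]
    exact gram_conj_of_conjSymm (gradedMainMatrix_conj_symm X₁ Y₁ X₂ f f' g₁ g₁' g₂ g₂') (star x)
  rw [Complex.le_def] at hx
  simp only [Complex.zero_re, Complex.zero_im, hreal, and_true, not_le] at hx
  unfold gradedQuadForm
  rw [gram_star_eq_dotProduct]
  exact hx

/-- **THE EXACT CRITERION ON THE CLASS (proved): `GradedClosesOn 𝒞 X₁ Y₁ X₂` iff some in-class design with its three pairs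
in `𝒞` has a main-term matrix that is NOT positive semidefinite** (class-relative `gradedCloses_iff_not_gradedPSD`; for a
Hermitian `3×3` matrix with non-negative diagonal this is Sylvester's «some 2×2 principal minor `< 0` or `det < 0`»).
[cite: Zhang2022LandauSiegel, §2 (2.16)–(2.17), §7 Prop 7.1 (7.2)] -/
theorem gradedClosesOn_iff_exists_not_posSemidef :
    GradedClosesOn 𝒞 X₁ Y₁ X₂ ↔ ∃ f f' g₁ g₁' g₂ g₂' : ℝ → ℂ, InClassPiece f f' ∧ InClassPiece g₁ g₁' ∧ InClassPiece g₂ g₂' ∧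
      𝒞 f f' g₁ g₁' ∧ 𝒞 f f' g₂ g₂' ∧ 𝒞 g₁ g₁' g₂ g₂' ∧ ¬ (gradedMainMatrix X₁ Y₁ X₂ f f' g₁ g₁' g₂ g₂').PosSemidef := by
  constructor
  · rintro ⟨f, f', g₁, g₁', g₂, g₂', s, hf, hg₁, hg₂, h01, h02, h12, hneg⟩
    refine ⟨f, f', g₁, g₁', g₂, g₂', hf, hg₁, hg₂, h01, h02, h12, fun hpsd => ?_⟩
    exact absurd hneg (not_lt.mpr (gradedQuadForm_nonneg_of_posSemidef hpsd s))
  · rintro ⟨f, f', g₁, g₁', g₂, g₂', hf, hg₁, hg₂, h01, h02, h12, h⟩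
    exact gradedClosesOn_of_not_posSemidef hf hg₁ hg₂ h01 h02 h12 h

/-! ### Part 2 — the determinant certificate -/

/-- **The determinant certificate (proved): `Re det < 0` at an in-class design with pairs in `𝒞` closes ON `𝒞`** — a PSD
matrix has `det ≥ 0` (`Matrix.PosSemidef.det_nonneg`; the determinant of the Hermitian main-term matrix is real, so the
hypothesis is `det < 0`). Unlike one violated 2×2 minor (`gradedClosesOn_of_minor··`) it fires on the coherent triple for
every cell mass above `𝔅/2` (Part 3). [cite: Zhang2022LandauSiegel, §2 (2.16)–(2.17), §7 Prop 7.1 (7.2)] -/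
theorem gradedClosesOn_of_det_neg (hf : InClassPiece f f') (hg₁ : InClassPiece g₁ g₁') (hg₂ : InClassPiece g₂ g₂')
    (h01 : 𝒞 f f' g₁ g₁') (h02 : 𝒞 f f' g₂ g₂') (h12 : 𝒞 g₁ g₁' g₂ g₂')
    (h : ((gradedMainMatrix X₁ Y₁ X₂ f f' g₁ g₁' g₂ g₂').det).re < 0) : GradedClosesOn 𝒞 X₁ Y₁ X₂ := by
  classical
  refine gradedClosesOn_of_not_posSemidef hf hg₁ hg₂ h01 h02 h12 fun hpsd => ?_
  have hdet := Complex.le_def.mp hpsd.det_nonneg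
  rw [Complex.zero_re] at hdet
  linarith [hdet.1]

/-! ### Part 3 — tightness of the row threshold: the coherent triple -/

section CoherentTriple

variable {B t : ℝ}

/-- **The coherent triple at amplitudes `(1,1,1)` (pure algebra):** with `𝔅(f) = 𝔅(g₁) = 𝔅(g₂) = B` and the three cells
`X₁(f,g₁) = Y₁(g₁,g₂) = X₂(f,g₂) = −t` (coherent phase `Re(X₁·Y₁·conj X₂) = −t³`), the graded form at `s = (1,1,1)` equals
`3B − 6t`. [cite: Zhang2022LandauSiegel, §2 (2.16)–(2.17)] -/
theorem coherentTriple_gradedQuadForm_ones (hBf : mainTermForm f f' = B) (hB1 : mainTermForm g₁ g₁' = B)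
    (hB2 : mainTermForm g₂ g₂' = B) (hX₁ : X₁ f f' g₁ g₁' = -(t : ℂ)) (hY₁ : Y₁ g₁ g₁' g₂ g₂' = -(t : ℂ))
    (hX₂ : X₂ f f' g₂ g₂' = -(t : ℂ)) :
    gradedQuadForm (gradedMainMatrix X₁ Y₁ X₂ f f' g₁ g₁' g₂ g₂') ![1, 1, 1] = 3 * B - 6 * t := by
  rw [gradedQuadForm_eq, hBf, hB1, hB2, hX₁, hY₁, hX₂]
  have hre : ((1 : ℂ) * conj ((1 : ℂ) * -(t : ℂ))).re = -t := by
    rw [one_mul, one_mul, map_neg, Complex.conj_ofReal, Complex.neg_re, Complex.ofReal_re]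
  simp only [Matrix.cons_val_zero, Matrix.cons_val_one, Matrix.head_cons, Matrix.cons_val_two, Matrix.tail_cons,
    norm_one, one_pow, mul_one, hre]
  ring

/-- **THE ROW THRESHOLD IS ATTAINED (proved): the coherent triple closes iff `B < 2t`** (`t ≥ 0`). (⇐) amplitudes `(1,1,1)`
give `3B − 6t < 0`; (⇒) every row has off-diagonal mass `2t ≤ B`, so the Gershgorin bound `gradedQuadForm_ge_rows` keeps the
form `≥ 0`. Hence the necessary row excess `𝔅 < |cell| + |cell|` of `exists_row_excess_of_gradedClosesOn` is also SUFFICIENT on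
this design: the constant `𝔅/2` per cell cannot be improved. [cite: Zhang2022LandauSiegel, §2 (2.16)–(2.17), §7 Prop 7.1 (7.2)] -/
theorem coherentTriple_closesAt_iff (ht : 0 ≤ t) (hBf : mainTermForm f f' = B) (hB1 : mainTermForm g₁ g₁' = B)
    (hB2 : mainTermForm g₂ g₂' = B) (hX₁ : X₁ f f' g₁ g₁' = -(t : ℂ)) (hY₁ : Y₁ g₁ g₁' g₂ g₂' = -(t : ℂ))
    (hX₂ : X₂ f f' g₂ g₂' = -(t : ℂ)) :
    (∃ s : Fin 3 → ℂ, gradedQuadForm (gradedMainMatrix X₁ Y₁ X₂ f f' g₁ g₁' g₂ g₂') s < 0) ↔ B < 2 * t := by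
  have hnorm : ‖-(t : ℂ)‖ = t := by rw [norm_neg, Complex.norm_real, Real.norm_of_nonneg ht]
  constructor
  · rintro ⟨s, hs⟩
    by_contra hle
    push Not at hle
    have hG := gradedQuadForm_ge_rows X₁ Y₁ X₂ f f' g₁ g₁' g₂ g₂' s
    rw [hBf, hB1, hB2, hX₁, hY₁, hX₂, hnorm] at hG
    nlinarith [mul_nonneg (show (0:ℝ) ≤ B - (t + t) by linarith) (sq_nonneg ‖s 0‖),
      mul_nonneg (show (0:ℝ) ≤ B - (t + t) by linarith) (sq_nonneg ‖s 1‖),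
      mul_nonneg (show (0:ℝ) ≤ B - (t + t) by linarith) (sq_nonneg ‖s 2‖)]
  · intro hB
    exact ⟨![1, 1, 1], by rw [coherentTriple_gradedQuadForm_ones hBf hB1 hB2 hX₁ hY₁ hX₂]; linarith⟩

/-- **Above the Gershgorin number the coherent triple closes ON the class (proved):** in-class pieces with the three pairs in
`𝒞`, equal side tables `B` and three coherent cells `−t` with `B < 2t` give `GradedClosesOn 𝒞 X₁ Y₁ X₂` (amplitudes
`(1,1,1)`). At linear `(θ = 0.9)³` of the desk display: `𝔅 = 41.99`, threshold `t > 21.00` per cell.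
[cite: Zhang2022LandauSiegel, §2 (2.16)–(2.17), §7 Prop 7.1 (7.2)] -/
theorem gradedClosesOn_coherentTriple (hf : InClassPiece f f') (hg₁ : InClassPiece g₁ g₁') (hg₂ : InClassPiece g₂ g₂')
    (h01 : 𝒞 f f' g₁ g₁') (h02 : 𝒞 f f' g₂ g₂') (h12 : 𝒞 g₁ g₁' g₂ g₂')
    (hBf : mainTermForm f f' = B) (hB1 : mainTermForm g₁ g₁' = B) (hB2 : mainTermForm g₂ g₂' = B)
    (hX₁ : X₁ f f' g₁ g₁' = -(t : ℂ)) (hY₁ : Y₁ g₁ g₁' g₂ g₂' = -(t : ℂ)) (hX₂ : X₂ f f' g₂ g₂' = -(t : ℂ))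
    (hB : B < 2 * t) : GradedClosesOn 𝒞 X₁ Y₁ X₂ :=
  ⟨f, f', g₁, g₁', g₂, g₂', ![1, 1, 1], hf, hg₁, hg₂, h01, h02, h12, by
    rw [coherentTriple_gradedQuadForm_ones hBf hB1 hB2 hX₁ hY₁ hX₂]; linarith⟩

/-- **The determinant of the coherent triple (pure algebra): `det = (B − 2t)(B + t)²`** — negative exactly when `B < 2t`
(for `B + t ≠ 0`), the eigenvalues being `B − 2t` (once, eigenvector `(1,1,1)`) and `B + t` (twice). [folklore] -/
theorem coherentTriple_det (hBf : mainTermForm f f' = B) (hB1 : mainTermForm g₁ g₁' = B) (hB2 : mainTermForm g₂ g₂' = B)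
    (hX₁ : X₁ f f' g₁ g₁' = -(t : ℂ)) (hY₁ : Y₁ g₁ g₁' g₂ g₂' = -(t : ℂ)) (hX₂ : X₂ f f' g₂ g₂' = -(t : ℂ)) :
    (gradedMainMatrix X₁ Y₁ X₂ f f' g₁ g₁' g₂ g₂').det = (((B - 2 * t) * (B + t) ^ 2 : ℝ) : ℂ) := by
  rw [Matrix.det_fin_three]
  simp only [gradedMainMatrix, hBf, hB1, hB2, hX₁, hY₁, hX₂, map_neg, Complex.conj_ofReal, Matrix.of_apply,
    Matrix.cons_val', Matrix.cons_val_zero, Matrix.cons_val_one, Matrix.cons_val_two, Matrix.empty_val',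
    Matrix.cons_val_fin_one, Matrix.head_cons, Matrix.tail_cons, Matrix.head_fin_const]
  push_cast
  ring

/-- **No 2×2 minor is violated on the coherent triple up to `t ≤ B` (proved):** all three minors `𝔅·𝔅 − |cell|² = B² − t²`
are `≥ 0`, so for `B/2 < t ≤ B` the design closes (`coherentTriple_closesAt_iff`, `gradedClosesOn_of_det_neg` with
`coherentTriple_det`) while the minor certificates `gradedClosesOn_of_minor01/02/12` are all silent.
[cite: Zhang2022LandauSiegel, §2 (2.16)–(2.17)] -/
theorem coherentTriple_minors_intact (ht : 0 ≤ t) (htB : t ≤ B) (hBf : mainTermForm f f' = B)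
    (hB1 : mainTermForm g₁ g₁' = B) (hB2 : mainTermForm g₂ g₂' = B) (hX₁ : X₁ f f' g₁ g₁' = -(t : ℂ))
    (hY₁ : Y₁ g₁ g₁' g₂ g₂' = -(t : ℂ)) (hX₂ : X₂ f f' g₂ g₂' = -(t : ℂ)) :
    ¬ mainTermForm f f' * mainTermForm g₁ g₁' < ‖X₁ f f' g₁ g₁'‖ ^ 2 ∧
      ¬ mainTermForm f f' * mainTermForm g₂ g₂' < ‖X₂ f f' g₂ g₂'‖ ^ 2 ∧
      ¬ mainTermForm g₁ g₁' * mainTermForm g₂ g₂' < ‖Y₁ g₁ g₁' g₂ g₂'‖ ^ 2 := by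
  have hnorm : ‖-(t : ℂ)‖ = t := by rw [norm_neg, Complex.norm_real, Real.norm_of_nonneg ht]
  rw [hBf, hB1, hB2, hX₁, hY₁, hX₂, hnorm, not_lt]
  have h : t ^ 2 ≤ B * B := by nlinarith
  exact ⟨h, h, h⟩

/-- **The certificate gap, assembled (proved):** for `B/2 < t` the coherent triple closes ON the class BY THE DETERMINANT
(`Re det = (B − 2t)(B + t)² < 0`, using `𝔅 ≥ 0`), although for `t ≤ B` no 2×2 minor is violated (`coherentTriple_minors_intact`). [cite: Zhang2022LandauSiegel, §2 (2.16)–(2.17), §7 Prop 7.1 (7.2)] -/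
theorem gradedClosesOn_coherentTriple_by_det (hf : InClassPiece f f') (hg₁ : InClassPiece g₁ g₁') (hg₂ : InClassPiece g₂ g₂')
    (h01 : 𝒞 f f' g₁ g₁') (h02 : 𝒞 f f' g₂ g₂') (h12 : 𝒞 g₁ g₁' g₂ g₂') (hB : B < 2 * t)
    (hBf : mainTermForm f f' = B) (hB1 : mainTermForm g₁ g₁' = B) (hB2 : mainTermForm g₂ g₂' = B)
    (hX₁ : X₁ f f' g₁ g₁' = -(t : ℂ)) (hY₁ : Y₁ g₁ g₁' g₂ g₂' = -(t : ℂ)) (hX₂ : X₂ f f' g₂ g₂' = -(t : ℂ)) :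
    GradedClosesOn 𝒞 X₁ Y₁ X₂ := by
  refine gradedClosesOn_of_det_neg hf hg₁ hg₂ h01 h02 h12 ?_
  rw [coherentTriple_det hBf hB1 hB2 hX₁ hY₁ hX₂, Complex.ofReal_re]
  have hBt : 0 < B + t := by
    have := mainTermForm_nonneg_of_isH1 hf.kinked.isH1
    rw [hBf] at this
    nlinarith
  nlinarith [sq_nonneg (B + t), mul_pos hBt hBt]

end CoherentTriple

end Summit.Parity.GeneralizedHardyLittlewood.Theorems.PsiGradedTablesClosePoly.Negative

end
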